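import Literature.InformationTheory.QuantumCodes.QuantumReedMullerDecoder
import Literature.InformationTheory.QuantumCodes.QuantumReedMullerCodesShortened
import HarnessLib

/-!
# Reed decoding of the SHORTENED quantum Reed–Muller codes `\overline{QRM}(a,m)` through the punctured position as an
# erasure: explicit sector decoders with the optimal radii `2^b − 1` (bit flips) and `2^a − 1` (phase flips)

Topic `Literature/InformationTheory/QuantumCodes`, namespace `Literature.InformationTheory.QuantumCodes.QRM` (venture QEC,
LADDER-QEC cell `qec`, PARTITION row 08, item «08.QRM» file 6; rung Q4). Continues `QuantumReedMullerDecoder.lean` (Reed sector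
decoders of the unshortened family; `sum_powerset_indicator`) and `QuantumReedMullerCodesShortened.lean` (`QRM.shortCode m a b`,
`a + b + 1 = m`: `[[2^m − 1, 1, 2^{min(a,b)+1} − 1]]`, `d_X = 2^{b+1} − 1`, `d_Z = 2^{a+1} − 1`; `shortGenMatrix_mulVec_eq_zero_iff`:
the kernel of `ℛ̄(r,m)` is the set of words whose EVEN extension to the point `0` lies in `ℛ(s,m)`, `r + s + 1 = m`).

The decoding problem on the `2^m − 1` nonzero points is the classical one for the PUNCTURED Reed–Muller code `ℛ(s,m)^*`
(MacWilliams–Sloane Ch. 13 §5: "the punctured RM code `ℛ(r,m)^*`"), of minimum distance `2^{m−s} − 1`; the punctured coordinate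
is a known position, i.e. an ERASURE for `ℛ(s,m)`. The decoder below runs Reed's algorithm (Ch. 13 §6) on BOTH completions of
the received word (value `0` and value `1` at the origin) and keeps a trial whose residual is light;
since one completion carries exactly the true error (weight `≤ 2^{m−s−1} − 1 <` half the distance) and two codewords of `ℛ(s,m)`
closer than `2^{m−s}` coincide, the kept residual IS the error. This realises the full radius `⌊(d^* − 1)/2⌋ = 2^{m−s−1} − 1` of
the punctured code.

* `liftSyndromeS r s` — explicit section of the shortened generator matrix (`Σ_S s_S Σ_{∅≠R⊆S} δ_{1_R}` on the nonzero points),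
  `shortGenMatrix_mulVec_liftSyndromeS`;
* `trialResidual s c y` (Reed residual of the completion of `y` by the value `c` at `0`), `reedErrorShort s y` (the two-trial
  rule), ★ `reedErrorShort_eq` (for `g ∈ ℛ(s,m)`, `s < m`, and an error `e` on the nonzero points with
  `2 · (wt(e)+1) · 2^s ≤ 2^m`, i.e. `wt(e) ≤ 2^{m−s−1} − 1`: `reedErrorShort s (restrict g + e) = e`);
* the sector decoders `reedDecodeShortX m b`, `reedDecodeShortZ m a` of `shortCode m a b` and ★ **`reedDecodeShortX_correctsUpTo`**
  (radius `2^b − 1 = ⌊(d_X−1)/2⌋`), ★ **`reedDecodeShortZ_correctsUpTo`** (radius `2^a − 1`), **`reedShort_decode_radius_optimal`**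
  (`1 ≤ a`, `1 ≤ b`: the explicit pair attains `2^{min(a,b)} − 1` in both sectors and no pair of sector decoders does better);
  instances `shortCode_15_1_3_reed` (ADP14's code: radius `1`/`1`… precisely bit flips `3 = 2^2 − 1`, phase flips `1`),
  `shortCode_31_1_7_reed` (`3`/`3`), `shortCode_127_1_15_reed` (`7`/`7`).

Column words: definitions (the printed algorithm + the standard erasure completion) + proved. HONEST FRAMING: code-capacity,
sector-wise adversarial radius; explicit finite functions, no complexity claim; nothing about gates or thresholds.

## References

* [MacWilliamsSloane1977] Ch. 13 §5 (punctured RM codes, chunk p0312–p0314), §6 Thm. 14 and the Reed decoding algorithm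
  (chunks p0315–p0317), §3 Thm. 3 (minimum distance).
* [LandahlCesare2013] §6 (shortened quantum Reed–Muller codes, chunk p0012); [AndersonDuclosCianciPoulin2014] p. 3 (`QRM(m)`).
* [NielsenChuang2010] §10.4.2 p. 450 (CSS decoding by the two classical decoders); [Gottesman1997] §2.3 (radius optimality).
-/

namespace Literature.InformationTheory.QuantumCodes

open Finset Matrix Literature.InformationTheory.Coding Literature.InformationTheory.Coding.ReedMuller

namespace QRM

variable {m : ℕ}

/-- Restricting an extension gives the word back (copy of the file-private lemma of the shortened-codes file). [folklore] -/
private theorem restrict_extend' (v : Pt m → ZMod 2) (c : ZMod 2) : restrict (extend v c) = v := by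
  funext x
  simp [restrict, extend, x.2]

/-- The weight of a word splits as the weight of its restriction plus the contribution of the point `0`. [folklore] -/
private theorem hammingNorm_eq_restrict' (g : (Fin m → ZMod 2) → ZMod 2) :
    hammingNorm g = hammingNorm (restrict g) + (if g 0 = 0 then 0 else 1) := by
  classical
  unfold hammingNorm
  rw [card_filter, card_filter, ← Finset.add_sum_erase _ _ (mem_univ (0 : Fin m → ZMod 2)), add_comm]
  congr 1
  · exact Finset.sum_subtype (univ.erase (0 : Fin m → ZMod 2)) (p := fun x => x ≠ 0) (fun x => by simp)
      (fun x => if g x ≠ 0 then 1 else 0)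
  · by_cases h : g 0 = 0 <;> simp [h]

/-! ### An explicit section of the shortened generator matrix -/

/-- A monomial at an indicator point: `v_T(1_R) = [T ⊆ R]`. [cite: MacWilliamsSloane1977, Ch. 13 §3 p. 373 (chunk p0306)] -/
private theorem monomialFun_indicator'' (T R : Finset (Fin m)) :
    monomialFun T (indicator R) = if T ⊆ R then 1 else 0 := by
  unfold monomialFun indicator
  rw [prod_boole]
  rfl

/-- The indicator point of a nonempty set is a nonzero point. [folklore] -/
private theorem indicator_ne_zero {R : Finset (Fin m)} (hR : R.Nonempty) : indicator R ≠ 0 := by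
  obtain ⟨i, hi⟩ := hR
  intro h
  have := congr_fun h i
  simp [indicator, hi] at this

/-- The indicator point of a nonempty `R` as a qubit of the shortened code. (definition) [folklore] -/
def indicatorPt (R : Finset (Fin m)) (hR : R.Nonempty) : Pt m := ⟨indicator R, indicator_ne_zero hR⟩

/-- **Section of the shortened generator matrix**: `s ↦ Σ_S s_S · Σ_{∅ ≠ R ⊆ S} δ_{1_R}` (point masses at the indicator points,
all nonzero). (definition) [folklore] -/
noncomputable def liftSyndromeS (r : ℕ) (s : MonoPos m r → ZMod 2) : Pt m → ZMod 2 :=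
  ∑ S : MonoPos m r, s S • ∑ R ∈ (S.1.powerset.filter fun R => R.Nonempty).attach,
    Pi.single (indicatorPt R.1 (mem_filter.1 R.2).2) (1 : ZMod 2)

/-- For nonempty `T`, restricting to NONEMPTY `R ⊆ S` does not change `Σ_R [T ⊆ R]`. [folklore] -/
private theorem sum_filter_nonempty_indicator {T S : Finset (Fin m)} (hT : T.Nonempty) :
    (∑ R ∈ (S.powerset.filter fun R => R.Nonempty).attach, (if T ⊆ R.1 then (1 : ZMod 2) else 0)) =
      if T = S then 1 else 0 := by
  classical
  rw [sum_attach (S.powerset.filter fun R => R.Nonempty) (fun R => if T ⊆ R then (1 : ZMod 2) else 0), sum_filter,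
    ← sum_powerset_indicator T S]
  refine sum_congr rfl fun R _ => ?_
  by_cases hR : R.Nonempty
  · rw [if_pos hR]
  · rw [if_neg hR, if_neg]
    intro hTR
    exact hR (hT.mono hTR)

/-- **The section is a right inverse** of the shortened generator matrix: `H̄ · liftSyndromeS(s) = s` for every `s`.
[cite: MacWilliamsSloane1977, Ch. 13 §3 p. 373 (chunk p0306: the monomial basis)] -/
theorem shortGenMatrix_mulVec_liftSyndromeS (r : ℕ) (s : MonoPos m r → ZMod 2) :
    shortGenMatrix m r *ᵥ liftSyndromeS r s = s := by
  classical
  funext T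
  rw [mulVec]
  change (fun x : Pt m => monomialFun T.1 x.1) ⬝ᵥ liftSyndromeS r s = s T
  unfold liftSyndromeS
  rw [dotProduct_sum]
  simp_rw [dotProduct_smul, dotProduct_sum, dotProduct_single, mul_one]
  have hrow : ∀ S : MonoPos m r,
      (∑ R ∈ (S.1.powerset.filter fun R => R.Nonempty).attach,
          monomialFun T.1 (indicatorPt R.1 (mem_filter.1 R.2).2).1) = if T.1 = S.1 then 1 else 0 := by
    intro S
    rw [← sum_filter_nonempty_indicator (card_pos.1 T.2.1)]
    refine sum_congr rfl fun R _ => ?_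
    exact monomialFun_indicator'' T.1 R.1
  simp_rw [hrow]
  rw [sum_eq_single T]
  · rw [if_pos rfl, smul_eq_mul, mul_one]
  · intro S _ hS
    rw [if_neg (fun h => hS (Subtype.ext h.symm)), smul_zero]
  · intro h; exact absurd (mem_univ T) h

/-! ### The two-trial Reed residual (the punctured position as an erasure) -/

/-- The Reed residual of the completion of `y` by the value `c` at the origin: `ỹ + reedDecode s ỹ`, `ỹ = extend y c`.
(definition) [cite: MacWilliamsSloane1977, Ch. 13 §6 (chunk p0316: the Reed decoding algorithm)] -/
noncomputable def trialResidual (s : ℕ) (c : ZMod 2) (y : Pt m → ZMod 2) : (Fin m → ZMod 2) → ZMod 2 :=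
  reedError s (extend y c)

/-- **The two-trial rule**: keep the `0`-completion's residual if it is light (`2·(wt+1)·2^s ≤ 2^m`), otherwise the
`1`-completion's; report its restriction to the nonzero points. (definition)
[cite: MacWilliamsSloane1977, Ch. 13 §6 (chunk p0316)] -/
noncomputable def reedErrorShort (s : ℕ) (y : Pt m → ZMod 2) : Pt m → ZMod 2 :=
  if 2 * ((hammingNorm (trialResidual s 0 y) + 1) * 2 ^ s) ≤ 2 ^ m
  then restrict (trialResidual s 0 y) else restrict (trialResidual s 1 y)

/-- The weight of the zero-extension of a word on the nonzero points is the weight of the word. [folklore] -/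
private theorem hammingNorm_extend_zero (e : Pt m → ZMod 2) : hammingNorm (extend e 0) = hammingNorm e := by
  classical
  unfold hammingNorm
  rw [card_filter, card_filter, ← Finset.add_sum_erase _ _ (mem_univ (0 : Fin m → ZMod 2))]
  rw [show (if extend e 0 0 ≠ 0 then 1 else 0) = 0 by simp [extend], zero_add]
  rw [Finset.sum_subtype (univ.erase (0 : Fin m → ZMod 2)) (p := fun x => x ≠ 0) (fun x => by simp)]
  refine sum_congr rfl fun x _ => ?_
  simp [extend, x.2]

/-- Restricting the zero-extension gives the word back, and it vanishes at the origin. [folklore] -/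
private theorem restrict_extend_zero (e : Pt m → ZMod 2) : restrict (extend e 0) = e ∧ extend e 0 0 = 0 := by
  refine ⟨?_, by simp [extend]⟩
  funext x
  simp [restrict, extend, x.2]

/-- Subadditivity of the Hamming weight. [folklore] -/
private theorem hammingNorm_add_le' {α : Type*} [Fintype α] [DecidableEq α] (u v : α → ZMod 2) :
    hammingNorm (u + v) ≤ hammingNorm u + hammingNorm v := by
  have h1 := hammingDist_triangle (u + v) v (0 : α → ZMod 2)
  rw [hammingDist_zero_right, hammingDist_zero_right, hammingDist_eq_hammingNorm] at h1
  have h2 : -(u + v) + v = u := by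
    funext i
    simp only [Pi.add_apply, Pi.neg_apply, CharTwo.neg_eq]
    rw [add_assoc, CharTwo.add_self_eq_zero, add_zero]
  rw [h2] at h1
  exact h1

/-- **Uniqueness below the distance**: two codewords of `ℛ(s,m)` at distance `< 2^{m−s}` are equal (MacWilliams–Sloane Ch. 13
Thm. 3). [cite: MacWilliamsSloane1977, Ch. 13 §3 Thm. 3 (chunk p0308)] -/
private theorem eq_of_hammingNorm_add_lt {s : ℕ} {c c' : (Fin m → ZMod 2) → ZMod 2} (hc : c ∈ ReedMuller.code s m)
    (hc' : c' ∈ ReedMuller.code s m) (h : hammingNorm (c + c') < 2 ^ (m - s)) : c = c' := by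
  by_contra hne
  have hne' : c + c' ≠ 0 := by
    intro h0
    apply hne
    funext x
    have := congr_fun h0 x
    rw [Pi.add_apply, Pi.zero_apply] at this
    -- in characteristic two `c x + c' x = 0` gives `c x = c' x`
    have h2 : c x = c x + c' x + c' x := by rw [add_assoc, CharTwo.add_self_eq_zero, add_zero]
    rw [h2, this, zero_add]
  have := ReedMullerMinDistance.two_pow_le_hammingNorm m s _ (Submodule.add_mem _ hc hc') hne'
  omega

/-- A trial whose residual is light has found the error: if `ỹ = extend (restrict g + e) c` (`g ∈ ℛ(s,m)`), the residual
`ρ = ỹ + reedDecode s ỹ` satisfies `2·(wt ρ + 1)·2^s ≤ 2^m`, and the true error has `2·(wt e + 1)·2^s ≤ 2^m`, then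
`restrict ρ = e` (the decoded codeword is within `< 2^{m−s}` of `g`, hence equals `g`). [cite: MacWilliamsSloane1977, Ch. 13 §3 Thm. 3 and §6 (chunks p0308, p0316)] -/
private theorem restrict_trialResidual_eq {s : ℕ} (hs : s < m) {g : (Fin m → ZMod 2) → ZMod 2}
    (hg : g ∈ ReedMuller.code s m) {e : Pt m → ZMod 2} (he : 2 * ((hammingNorm e + 1) * 2 ^ s) ≤ 2 ^ m) (c : ZMod 2)
    (hρ : 2 * ((hammingNorm (trialResidual s c (restrict g + e)) + 1) * 2 ^ s) ≤ 2 ^ m) :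
    restrict (trialResidual s c (restrict g + e)) = e := by
  -- the decoded codeword
  set y := extend (restrict g + e) c with hy
  set c' := reedDecode s y with hc'
  have hc'mem : c' ∈ ReedMuller.code s m := reedDecode_mem_code s y
  have hρdef : trialResidual s c (restrict g + e) = y + c' := rfl
  -- `y = g + (δ + extend e 0)` where `δ` is supported at the origin
  have hyg : restrict (y + g) = e := by
    funext x
    show (extend (restrict g + e) c) x.1 + g x.1 = e x
    unfold extend
    rw [dif_neg x.2, Subtype.coe_eta]
    show g x.1 + e x + g x.1 = e x
    calc g x.1 + e x + g x.1 = e x + (g x.1 + g x.1) := by ring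
      _ = e x := by rw [CharTwo.add_self_eq_zero, add_zero]
  -- compare `g` and `c'`: `g + c' = (y + g) + (y + c')`, both light
  have hsum : g + c' = (y + g) + (y + c') := by
    calc g + c' = g + c' + (y + y) := by
          rw [show y + y = 0 from funext fun x => CharTwo.add_self_eq_zero _, add_zero]
      _ = (y + g) + (y + c') := by abel
  have hwt1 : hammingNorm (y + g) ≤ hammingNorm e + 1 := by
    rw [hammingNorm_eq_restrict' (y + g), hyg]
    split_ifs <;> omega
  have hwt2 : hammingNorm (y + c') = hammingNorm (trialResidual s c (restrict g + e)) := by rw [hρdef]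
  have hlt : hammingNorm (g + c') < 2 ^ (m - s) := by
    rw [hsum]
    refine lt_of_le_of_lt (hammingNorm_add_le' (y + g) (y + c')) ?_
    have h2 : 2 ^ (m - s) = 2 * 2 ^ (m - s - 1) := by rw [← pow_succ']; congr 1; omega
    have h3 : 2 ^ m = 2 ^ s * (2 * 2 ^ (m - s - 1)) := by rw [← h2, ← pow_add]; congr 1; omega
    rw [h3] at he hρ
    have hp : 0 < 2 ^ s := Nat.two_pow_pos s
    have he' : hammingNorm e + 1 ≤ 2 ^ (m - s - 1) := by nlinarith
    have hρ' : hammingNorm (trialResidual s c (restrict g + e)) + 1 ≤ 2 ^ (m - s - 1) := by nlinarith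
    rw [hwt2] ; omega
  have hgc : g = c' := eq_of_hammingNorm_add_lt hg hc'mem hlt
  -- hence the residual is `y + g`, whose restriction is `e`
  rw [hρdef, ← hgc, hyg]

/-- ★ **The two-trial Reed decoder of the punctured code is exact up to `⌊(2^{m−s} − 2)/2⌋` errors**: for `g ∈ ℛ(s,m)`, `s < m`,
and an error `e` on the nonzero points with `2·(wt(e)+1)·2^s ≤ 2^m` (i.e. `wt(e) ≤ 2^{m−s−1} − 1`),
`reedErrorShort s (restrict g + e) = e`. [cite: MacWilliamsSloane1977, Ch. 13 §6 (chunk p0316: "will clearly work for any RM code") and §5 (punctured RM codes, chunk p0314)] -/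
theorem reedErrorShort_eq {s : ℕ} (hs : s < m) {g : (Fin m → ZMod 2) → ZMod 2} (hg : g ∈ ReedMuller.code s m)
    {e : Pt m → ZMod 2} (he : 2 * ((hammingNorm e + 1) * 2 ^ s) ≤ 2 ^ m) : reedErrorShort s (restrict g + e) = e := by
  unfold reedErrorShort
  split_ifs with htest
  · exact restrict_trialResidual_eq hs hg he 0 htest
  · -- the completion by the true parity `g 0` carries exactly the error `extend e 0`; it is one of the two trials
    have hgood : ∀ c : ZMod 2, c = g 0 → trialResidual s c (restrict g + e) = extend e 0 := by
      intro c hc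
      subst hc
      have hy : extend (restrict g + e) (g 0) = g + extend e 0 := by
        funext x
        by_cases hx : x = 0
        · subst hx; simp [extend]
        · simp [extend, hx, restrict]
      unfold trialResidual
      rw [hy]
      refine reedError_eq hg ?_
      rw [hammingNorm_extend_zero]
      have : 2 ^ m = 2 ^ s * (2 * 2 ^ (m - s - 1)) := by rw [← pow_succ', ← pow_add]; congr 1; omega
      nlinarith [Nat.two_pow_pos s, Nat.two_pow_pos (m - s - 1)]
    have h01 : ∀ c : ZMod 2, c = 0 ∨ c = 1 := by decide
    rcases h01 (g 0) with h0 | h1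
    · -- then trial `0` is the good one and passes the test: contradiction with `htest`
      exfalso
      apply htest
      rw [hgood 0 h0.symm, hammingNorm_extend_zero]
      exact he
    · rw [hgood 1 h1.symm]
      exact (restrict_extend_zero e).1

/-! ### The sector decoders of the shortened codes -/

/-- **The bit-flip decoder of `\overline{QRM}(a,m)`** (`shortCode m a b`): lift the `Z`-syndrome, then the two-trial Reed
residual for `ℛ(m−b−1,m)`. (definition) [cite: MacWilliamsSloane1977, Ch. 13 §6 (chunk p0316)] [cite: NielsenChuang2010, §10.4.2 (p. 450)] -/
noncomputable def reedDecodeShortX (m b : ℕ) : Decoder (MonoPos m b → ZMod 2) (Pt m → ZMod 2) :=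
  fun s => reedErrorShort (m - b - 1) (liftSyndromeS b s)

/-- **The phase-flip decoder of `\overline{QRM}(a,m)`**: the same on the `X`-syndrome, Reed for `ℛ(m−a−1,m)`. (definition)
[cite: MacWilliamsSloane1977, Ch. 13 §6 (chunk p0316)] [cite: NielsenChuang2010, §10.4.2 (p. 450)] -/
noncomputable def reedDecodeShortZ (m a : ℕ) : Decoder (MonoPos m a → ZMod 2) (Pt m → ZMod 2) :=
  fun s => reedErrorShort (m - a - 1) (liftSyndromeS a s)

/-- The lifted syndrome of `e` is `restrict g + e` for a word `g ∈ ℛ(s,m)` (`r + s + 1 = m`). [cite: MacWilliamsSloane1977, Ch. 13 §3 Thm. 4 (chunks p0308-p0309)] -/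
theorem liftSyndromeS_eq_restrict_add {r s : ℕ} (h : r + s + 1 = m) (e : Pt m → ZMod 2) :
    ∃ g ∈ ReedMuller.code s m, liftSyndromeS r (shortGenMatrix m r *ᵥ e) = restrict g + e := by
  set y := liftSyndromeS r (shortGenMatrix m r *ᵥ e)
  have hker : shortGenMatrix m r *ᵥ (y + e) = 0 := by
    rw [mulVec_add, shortGenMatrix_mulVec_liftSyndromeS]
    funext T; exact CharTwo.add_self_eq_zero _
  refine ⟨evenExt (y + e), (shortGenMatrix_mulVec_eq_zero_iff h _).1 hker, ?_⟩
  rw [show restrict (evenExt (y + e)) = y + e from restrict_extend' _ _, add_assoc,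
    show e + e = 0 from funext fun x => CharTwo.add_self_eq_zero _, add_zero]

/-- ★ **The shortened Reed bit-flip decoder corrects every `X`-pattern of weight `≤ 2^b − 1`** on `shortCode m a b` — the
optimal `X`-sector radius `⌊(d_X − 1)/2⌋`, `d_X = 2^{b+1} − 1`. [cite: MacWilliamsSloane1977, Ch. 13 §6 (chunk p0316)] [cite: NielsenChuang2010, §10.4.2 (p. 450)] -/
theorem reedDecodeShortX_correctsUpTo {a b : ℕ} (h : a + b + 1 = m) :
    (reedDecodeShortX m b).CorrectsUpTo (shortCode m a b h).xSyndrome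
      ((shortCode m a b h).rowSpX : Set (Pt m → ZMod 2)) hammingNorm (2 ^ b - 1) := by
  intro e he
  show reedDecodeShortX m b ((shortCode m a b h).xSyndrome e) + e ∈ ((shortCode m a b h).rowSpX : Set (Pt m → ZMod 2))
  rw [CSSCode.xSyndrome_apply, shortCode_HZ]
  unfold reedDecodeShortX
  obtain ⟨g, hg, hyg⟩ := liftSyndromeS_eq_restrict_add (r := b) (s := a) (by omega) e
  rw [hyg, show m - b - 1 = a by omega, reedErrorShort_eq (by omega) hg ?_]
  · have : e + e = 0 := by funext q; exact CharTwo.add_self_eq_zero _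
    rw [this]
    exact (shortCode m a b h).rowSpX.zero_mem
  · have hp : 0 < 2 ^ b := Nat.two_pow_pos b
    have h2 : 2 ^ m = 2 ^ a * (2 * 2 ^ b) := by rw [← pow_succ', ← pow_add]; congr 1; omega
    rw [h2]
    have : hammingNorm e + 1 ≤ 2 ^ b := by omega
    nlinarith [Nat.two_pow_pos a]

/-- ★ **The shortened Reed phase-flip decoder corrects every `Z`-pattern of weight `≤ 2^a − 1`** on `shortCode m a b` — the
optimal `Z`-sector radius, `d_Z = 2^{a+1} − 1`. [cite: MacWilliamsSloane1977, Ch. 13 §6 (chunk p0316)] [cite: NielsenChuang2010, §10.4.2 (p. 450)] -/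
theorem reedDecodeShortZ_correctsUpTo {a b : ℕ} (h : a + b + 1 = m) :
    (reedDecodeShortZ m a).CorrectsUpTo (shortCode m a b h).zSyndrome
      ((shortCode m a b h).rowSpZ : Set (Pt m → ZMod 2)) hammingNorm (2 ^ a - 1) := by
  intro e he
  show reedDecodeShortZ m a ((shortCode m a b h).zSyndrome e) + e ∈ ((shortCode m a b h).rowSpZ : Set (Pt m → ZMod 2))
  rw [CSSCode.zSyndrome, shortCode_HX]
  unfold reedDecodeShortZ
  obtain ⟨g, hg, hyg⟩ := liftSyndromeS_eq_restrict_add (r := a) (s := b) h e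
  rw [hyg, show m - a - 1 = b by omega, reedErrorShort_eq (by omega) hg ?_]
  · have : e + e = 0 := by funext q; exact CharTwo.add_self_eq_zero _
    rw [this]
    exact (shortCode m a b h).rowSpZ.zero_mem
  · have hp : 0 < 2 ^ a := Nat.two_pow_pos a
    have h2 : 2 ^ m = 2 ^ b * (2 * 2 ^ a) := by rw [← pow_succ', ← pow_add]; congr 1; omega
    rw [h2]
    have : hammingNorm e + 1 ≤ 2 ^ a := by omega
    nlinarith [Nat.two_pow_pos b]

/-- `⌊(2^{c+1} − 1 − 1)/2⌋ = 2^c − 1`. [folklore] -/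
private theorem two_pow_succ_sub_two_div_two (c : ℕ) : (2 ^ (c + 1) - 1 - 1) / 2 = 2 ^ c - 1 := by
  have : 0 < 2 ^ c := Nat.two_pow_pos c
  rw [pow_succ]
  omega

/-- ★ **The explicit two-trial Reed decoders ATTAIN the optimal radius of the shortened codes** (`a + b + 1 = m`): both
sectors are corrected up to weight `2^{min(a,b)} − 1 = ⌊(d−1)/2⌋`, and no pair of sector decoders does better.
[cite: Gottesman1997, §2.3 (chunk p0014 L3)] [cite: MacWilliamsSloane1977, Ch. 13 §6 (chunk p0316)] -/
theorem reedShort_decode_radius_optimal {a b : ℕ} (h : a + b + 1 = m) :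
    ((reedDecodeShortX m b).CorrectsUpTo (shortCode m a b h).xSyndrome
        ((shortCode m a b h).rowSpX : Set (Pt m → ZMod 2)) hammingNorm (2 ^ min a b - 1) ∧
      (reedDecodeShortZ m a).CorrectsUpTo (shortCode m a b h).zSyndrome
        ((shortCode m a b h).rowSpZ : Set (Pt m → ZMod 2)) hammingNorm (2 ^ min a b - 1)) ∧
    ∀ (DX : Decoder (MonoPos m b → ZMod 2) (Pt m → ZMod 2)) (DZ : Decoder (MonoPos m a → ZMod 2) (Pt m → ZMod 2)) (t : ℕ),
      DX.CorrectsUpTo (shortCode m a b h).xSyndrome ((shortCode m a b h).rowSpX : Set (Pt m → ZMod 2)) hammingNorm t →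
        DZ.CorrectsUpTo (shortCode m a b h).zSyndrome ((shortCode m a b h).rowSpZ : Set (Pt m → ZMod 2)) hammingNorm t →
          t ≤ 2 ^ min a b - 1 := by
  refine ⟨⟨(reedDecodeShortX_correctsUpTo h).mono ?_, (reedDecodeShortZ_correctsUpTo h).mono ?_⟩, fun DX DZ t hX hZ => ?_⟩
  · exact Nat.sub_le_sub_right (Nat.pow_le_pow_right (by norm_num) (min_le_right a b)) 1
  · exact Nat.sub_le_sub_right (Nat.pow_le_pow_right (by norm_num) (min_le_left a b)) 1
  · have := (shortCode_isCode h).le_half_of_correctsUpTo_sectors hX hZ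
    rwa [two_pow_succ_sub_two_div_two] at this

/-- **`[[15, 1, 3]]`** (ADP14's code, `m = 4`, `a = 1`, `b = 2`): the explicit decoders correct every pattern of up to
`3 = 2^2 − 1` bit flips and every single phase flip (the optimal sector radii, `d_X = 7`, `d_Z = 3`).
[cite: AndersonDuclosCianciPoulin2014, p. 3 (chunk p0003)] -/
theorem shortCode_15_1_3_reed :
    (reedDecodeShortX 4 2).CorrectsUpTo (shortCode 4 1 2 rfl).xSyndrome
        ((shortCode 4 1 2 rfl).rowSpX : Set (Pt 4 → ZMod 2)) hammingNorm 3 ∧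
      (reedDecodeShortZ 4 1).CorrectsUpTo (shortCode 4 1 2 rfl).zSyndrome
        ((shortCode 4 1 2 rfl).rowSpZ : Set (Pt 4 → ZMod 2)) hammingNorm 1 :=
  ⟨reedDecodeShortX_correctsUpTo (m := 4) (a := 1) (b := 2) rfl, reedDecodeShortZ_correctsUpTo (m := 4) (a := 1) (b := 2) rfl⟩

/-- **`[[31, 1, 7]]`** (`m = 5`, `a = b = 2`): radius `3` in both sectors, optimal. [cite: LandahlCesare2013, §6 (chunk p0012)] -/
theorem shortCode_31_1_7_reed :
    (reedDecodeShortX 5 2).CorrectsUpTo (shortCode 5 2 2 rfl).xSyndrome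
        ((shortCode 5 2 2 rfl).rowSpX : Set (Pt 5 → ZMod 2)) hammingNorm 3 ∧
      (reedDecodeShortZ 5 2).CorrectsUpTo (shortCode 5 2 2 rfl).zSyndrome
        ((shortCode 5 2 2 rfl).rowSpZ : Set (Pt 5 → ZMod 2)) hammingNorm 3 :=
  ⟨reedDecodeShortX_correctsUpTo (m := 5) (a := 2) (b := 2) rfl, reedDecodeShortZ_correctsUpTo (m := 5) (a := 2) (b := 2) rfl⟩

/-- **`[[127, 1, 15]]`** (`m = 7`, `a = b = 3`): radius `7` in both sectors, optimal. [cite: LandahlCesare2013, §6 (chunk p0012)] -/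
theorem shortCode_127_1_15_reed :
    (reedDecodeShortX 7 3).CorrectsUpTo (shortCode 7 3 3 rfl).xSyndrome
        ((shortCode 7 3 3 rfl).rowSpX : Set (Pt 7 → ZMod 2)) hammingNorm 7 ∧
      (reedDecodeShortZ 7 3).CorrectsUpTo (shortCode 7 3 3 rfl).zSyndrome
        ((shortCode 7 3 3 rfl).rowSpZ : Set (Pt 7 → ZMod 2)) hammingNorm 7 :=
  ⟨reedDecodeShortX_correctsUpTo (m := 7) (a := 3) (b := 3) rfl, reedDecodeShortZ_correctsUpTo (m := 7) (a := 3) (b := 3) rfl⟩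

end QRM

end Literature.InformationTheory.QuantumCodes
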